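import Summits.NavierStokesRegularity.FluidComputer.GateBudget
import HarnessLib

/-!
# What no tuning can beat, part 5: the AFTERGLOW LAWS — clock recovery, pulse lifetime, pulse
# decay under a reversed clock, and the CARRIER FREEZE (what a dead clock still lets through)

Cell `pub-fluidc`, blueprint seat bp1 (gen 23); same namespace and conventions as parts 1–4
(`GateBudget.lean`, `GateBudgetArming.lean`, `GateBudgetZeno.lean`, `GateBudgetDrain.lean`); this
part imports part 1 only. HONEST FRAMING (verbatim): low prior, high value-of-information experiment
on Tao's machine paradigm; NOT a claim that NS blows up. Five-mode quadratic ODEs on `ℝ⁵`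
(`fiveGateCircuit ε σ μ R K`: CLOCK pump `ε : a → b`, SEED pump `σ : a → c`, TRIGGER amplifier
`μ : b ⇒ c`, rotor `R : c ∘ (a,d)`, DRAIN pump `K : d → ã`; Tao's retuned family
`delayCircuitWith K M ε` is the slice `σ = ε²e^{-M}, μ = ε⁻¹M, R = ε⁻²`) started EXACTLY at (5.6)
`delayInit`; nothing is proved about the Navier–Stokes equations.

## Why this part exists (the toy finding it types)

At toy scale (bp1 gen 22, kit j088474; gen 23, kit j089201) the clock `b` does NOT stay positive
while the gate fires: the pulse `c` draws the clock down through zero AT firing (`min b/ε ≈ -1.5`),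
after which the amplifier runs BACKWARDS (`∂ₜc = σa² + μbc` with `b < 0`), the pulse dies, the
rotor stops, and whatever energy is still in the carrier `a` at that moment STAYS there (`∂ₜa =
-Rcd - εab - σac → 0`), while the `d` already rotated out drains completely into `ã`. Complete
transfer then happens either ROBUSTLY (the rotor kept turning for the whole drain-limited douse) or
by PHASE LUCK (the rotor stopped with the `(a,d)` oscillator at `a ≈ 0`) — the second branch is why
no universal law "fires ⇒ seed exponentially small" can hold. This file proves the deterministic
skeleton of that picture, as one-sided laws valid for EVERY member of the five-coupling family
(signs only), read at the level of derivatives (no integrals appear):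

* CLOCK RECOVERY (`clock_recovery`): `∂ₜb ≤ ε`, so `b(t) ≤ b(s) + ε(t-s)`: a clock driven down to
  `-β₀` stays `≤ -β₀/2` for a time `β₀/(2ε)` (`clock_stays_reversed`).
* PULSE LIFETIME (`clock_drawn_down`, `pulse_kills_clock`): while `c ≥ γ` the clock loses `μγ²` per
  unit time and gains at most `ε`: a pulse of height `γ` lasting `τ` with `μγ²τ > (ε+σ)T + ετ`
  kills the clock (`b(T+τ) < 0`). Tao's family: `2T + τ < Mγ̂²τ` for a pulse `c ≥ γ̂ε`
  (`taoFamily_pulse_kills_clock`).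
* PULSE DECAY (`pulse_decay`): if `b ≤ -β < 0` on `[T,T']` then
  `c(t) ≤ c(T)e^{-μβ(t-T)} + σ/(μβ)` there — a reversed clock extinguishes the trigger down to the
  seed floor, whatever the rotor and drain do.
* CARRIER FREEZE / AFTERGLOW (`carrier_freeze`, `afterglow_law`, `afterglow_selftimed`): on the same
  window `a(t)² ≥ a(T)² - 2(R+σ)(c(T) + σ(t-T))/(μβ)`, hence by (energy-con)
  `ã(t)² ≤ 1 - a(T)² + 2(R+σ)(c(T) + σ(t-T))/(μβ)`: once the clock is reversed and the rotor rate
  `R·c(T)` has fallen below `μβ ×` (tolerance), the gate can deliver no more than the energy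
  already OUT of the carrier. Tao's family (`taoFamily_afterglow`): `ã(t)² ≤ 1 - a(T)² + 4(c(T) +
  ε²e^{-M}(t-T))/(εMβ)` — in units `c = γ̂ε`, `β = β̂ε` the residual rotor ACTION after clock
  reversal is `≲ γ̂/(εMβ̂)` radians, so the freeze sets in `log(1/(εM))` e-folds (time `≈
  log(1/(εM))/(Mβ̂)`) after clock death; the phase of the `(a,d)` oscillator at that moment — which
  these one-sided laws cannot see — decides the output.

HONEST LIMITS. Necessary-direction inequalities only (no statement that the clock DOES die, no phase
prediction); `0` named facts; `0` sorry. [cite: Tao2016AveragedNS, §5.5 Theorem 5.3, (5.5), (b-eq),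
(energy-con), proof ("comparison argument")].
-/

noncomputable section

namespace Summit.NavierStokesRegularity.FluidComputer.GateBudget

open Real Set Filter Topology
open Literature.Analysis.FluidPDE.Tao2016AveragedNS
open Literature.Analysis.FluidPDE.Tao2016AveragedNS.Thm53 (antitoneOn_intFactor monotoneOn_intFactor
  antitoneOn_sub_of_deriv_le monotoneOn_sub_of_le_deriv init_a init_b init_c init_d init_e)

variable {ε σ μ R K : ℝ} {X : ℝ → Fin 5 → ℝ}

/-! ## §9 The carrier equation and the clock-recovery law -/

/-- (a-eq): `∂ₜa = -Rcd - εab - σac`. [cite: Tao2016AveragedNS, §5.5 (5.5)] -/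
theorem hasDerivAt_a (hX : ∀ t, HasDerivAt X (fiveGateCircuit ε σ μ R K (X t)) t) (t : ℝ) :
    HasDerivAt (fun s => X s 0) (-(R * X t 2 * X t 3) - ε * X t 0 * X t 1 - σ * X t 0 * X t 2) t :=
  (hasDerivAt_pi.1 (hX t) 0).congr_deriv (by simp [fiveGateCircuit])

/-- `∂ₜ(a²) = -2Rcad - 2εa²b - 2σa²c`. [cite: Tao2016AveragedNS, §5.5 (5.5)] -/
theorem hasDerivAt_a_sq (hX : ∀ t, HasDerivAt X (fiveGateCircuit ε σ μ R K (X t)) t) (t : ℝ) :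
    HasDerivAt (fun s => X s 0 ^ 2) (-(2 * R * X t 2 * X t 0 * X t 3)
      - 2 * ε * X t 0 ^ 2 * X t 1 - 2 * σ * X t 0 ^ 2 * X t 2) t := by
  refine ((hasDerivAt_a hX t).fun_pow 2).congr_deriv ?_
  simp only [show (2 : ℕ) - 1 = 1 from rfl, pow_one, Nat.cast_ofNat]
  ring

/-- **CLOCK RECOVERY LAW.** `∂ₜb = εa² - μc² ≤ ε` (`ε, μ ≥ 0`, `a² ≤ 1`): `b(t) ≤ b(s) + ε(t-s)` for
`s ≤ t` — however the clock was drawn down, it recovers no faster than the pump `ε` refills it.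
[cite: Tao2016AveragedNS, §5.5 (b-eq)] -/
theorem clock_recovery (hX : ∀ t, HasDerivAt X (fiveGateCircuit ε σ μ R K (X t)) t)
    (h0 : X 0 = delayInit) (hε : 0 ≤ ε) (hμ : 0 ≤ μ) {s t : ℝ} (hst : s ≤ t) :
    X t 1 ≤ X s 1 + ε * (t - s) := by
  have hanti := antitoneOn_sub_of_deriv_le (f := fun r => X r 1)
    (f' := fun r => ε * X r 0 ^ 2 - μ * X r 2 ^ 2) (φ := fun _ => ε) (Φ := fun r => ε * r)
    convex_univ (fun r _ => hasDerivAt_b hX r)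
    (fun r _ => ((hasDerivAt_id' r).const_mul ε).congr_deriv (by simp))
    (fun r _ => by
      have ha : X r 0 ^ 2 ≤ 1 := traj_sq_le_one hX h0 r 0
      show ε * X r 0 ^ 2 - μ * X r 2 ^ 2 ≤ ε
      nlinarith [mul_le_mul_of_nonneg_left ha hε, mul_nonneg hμ (sq_nonneg (X r 2))])
  have h := hanti (mem_univ s) (mem_univ t) hst
  dsimp only at h
  linarith

/-- **A REVERSED CLOCK STAYS REVERSED** for `β₀/(2ε)`: if `b(T) ≤ -β₀` then `b(t) ≤ -β₀/2` on
`[T, T + β₀/(2ε)]` (`ε > 0`, `μ ≥ 0`). [cite: Tao2016AveragedNS, §5.5 (b-eq)] -/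
theorem clock_stays_reversed (hX : ∀ t, HasDerivAt X (fiveGateCircuit ε σ μ R K (X t)) t)
    (h0 : X 0 = delayInit) (hε : 0 < ε) (hμ : 0 ≤ μ) {T β₀ : ℝ} (hb : X T 1 ≤ -β₀) {t : ℝ}
    (ht : t ∈ Icc T (T + β₀ / (2 * ε))) : X t 1 ≤ -(β₀ / 2) := by
  have h := clock_recovery hX h0 hε.le hμ ht.1
  have h3 : t - T ≤ β₀ / (2 * ε) := by linarith [ht.2]
  have h2 : ε * (t - T) ≤ β₀ / 2 :=
    calc ε * (t - T) ≤ ε * (β₀ / (2 * ε)) := mul_le_mul_of_nonneg_left h3 hε.le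
      _ = β₀ / 2 := by field_simp
  linarith

/-! ## §10 The pulse-lifetime law: a sustained trigger kills the clock -/

/-- **CLOCK DRAW-DOWN.** If the trigger holds `c ≥ γ ≥ 0` throughout `[T, T+τ]` then
`b(T+τ) ≤ b(T) + ετ - μγ²τ` (`ε, μ ≥ 0`): the amplifier takes `μc² ≥ μγ²` from the clock per unit
time while the pump returns at most `εa² ≤ ε`. [cite: Tao2016AveragedNS, §5.5 (b-eq)] -/
theorem clock_drawn_down (hX : ∀ t, HasDerivAt X (fiveGateCircuit ε σ μ R K (X t)) t)
    (h0 : X 0 = delayInit) (hε : 0 ≤ ε) (hμ : 0 ≤ μ) {T τ γ : ℝ} (hτ : 0 ≤ τ) (hγ : 0 ≤ γ)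
    (hc : ∀ t ∈ Icc T (T + τ), γ ≤ X t 2) :
    X (T + τ) 1 ≤ X T 1 + ε * τ - μ * γ ^ 2 * τ := by
  have hanti := antitoneOn_sub_of_deriv_le (f := fun r => X r 1)
    (f' := fun r => ε * X r 0 ^ 2 - μ * X r 2 ^ 2) (φ := fun _ => ε - μ * γ ^ 2)
    (Φ := fun r => (ε - μ * γ ^ 2) * r) (convex_Icc T (T + τ)) (fun r _ => hasDerivAt_b hX r)
    (fun r _ => ((hasDerivAt_id' r).const_mul (ε - μ * γ ^ 2)).congr_deriv (by simp))
    (fun r hr => by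
      have ha : X r 0 ^ 2 ≤ 1 := traj_sq_le_one hX h0 r 0
      have hγc : γ ^ 2 ≤ X r 2 ^ 2 := pow_le_pow_left₀ hγ (hc r hr) 2
      show ε * X r 0 ^ 2 - μ * X r 2 ^ 2 ≤ ε - μ * γ ^ 2
      nlinarith [mul_le_mul_of_nonneg_left ha hε, mul_le_mul_of_nonneg_left hγc hμ])
  have h := hanti (left_mem_Icc.2 (by linarith)) (right_mem_Icc.2 (by linarith)) (by linarith)
  dsimp only at h
  linarith

/-- **PULSE LIFETIME LAW.** A trigger pulse of height `c ≥ γ` on `[T, T+τ]` with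
`μγ²τ > (ε+σ)T + ετ` kills the clock: `b(T+τ) < 0` (`T, τ ≥ 0`; `ε, σ, μ ≥ 0`; using the trigger
budget `b(T) ≤ (ε+σ)T` of part 1). Read contrapositively: the clock survives a pulse of height `γ`
for at most `τ ≤ (ε+σ)T/(μγ² - ε)`. [cite: Tao2016AveragedNS, §5.5 (b-eq), proof (ob-2)] -/
theorem pulse_kills_clock (hX : ∀ t, HasDerivAt X (fiveGateCircuit ε σ μ R K (X t)) t)
    (h0 : X 0 = delayInit) (hε : 0 ≤ ε) (hσ : 0 ≤ σ) (hμ : 0 ≤ μ) {T τ γ : ℝ} (hT : 0 ≤ T)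
    (hτ : 0 ≤ τ) (hγ : 0 ≤ γ) (hc : ∀ t ∈ Icc T (T + τ), γ ≤ X t 2)
    (hlong : (ε + σ) * T + ε * τ < μ * γ ^ 2 * τ) : X (T + τ) 1 < 0 := by
  have h1 := clock_drawn_down hX h0 hε hμ hτ hγ hc
  have h2 : X T 1 ≤ (ε + σ) * T := (le_abs_self _).trans (abs_b_le hX h0 hε hσ hT)
  linarith

/-! ## §11 The pulse-decay law: a reversed clock extinguishes the trigger -/

/-- **PULSE DECAY LAW.** If the clock is reversed, `b ≤ -β` on `[T, T']` (`β > 0`, `μ > 0`, `σ ≥ 0`,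
`T ≥ 0`), the amplifier runs backwards and the trigger decays exponentially to the seed floor:
`c(t) ≤ c(T)e^{-μβ(t-T)} + σ/(μβ)` for `t ∈ [T, T']` (integrating factor `e^{μβt}`:
`∂ₜc + μβc = σa² + μc(b + β) ≤ σ` since `c ≥ 0`). [cite: Tao2016AveragedNS, §5.5 (5.5), proof
("comparison argument")] -/
theorem pulse_decay (hX : ∀ t, HasDerivAt X (fiveGateCircuit ε σ μ R K (X t)) t)
    (h0 : X 0 = delayInit) (hσ : 0 ≤ σ) (hμ : 0 < μ) {T T' β : ℝ} (hT : 0 ≤ T) (hβ : 0 < β)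
    (hb : ∀ t ∈ Icc T T', X t 1 ≤ -β) {t : ℝ} (ht : t ∈ Icc T T') :
    X t 2 ≤ X T 2 * exp (-(μ * β * (t - T))) + σ / (μ * β) := by
  have hk : 0 < μ * β := mul_pos hμ hβ
  have hμ0 : μ ≠ 0 := hμ.ne'
  have hβ0 : β ≠ 0 := hβ.ne'
  have hanti := antitoneOn_intFactor (f := fun r => X r 2)
    (f' := fun r => σ * X r 0 ^ 2 + μ * X r 1 * X r 2) (g := fun _ => -(μ * β))
    (G := fun r => -(μ * β) * r) (φ := fun r => σ * exp (μ * β * r))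
    (Φ := fun r => σ / (μ * β) * exp (μ * β * r)) (convex_Icc T T') (fun r _ => hasDerivAt_c hX r)
    (fun r _ => ((hasDerivAt_id' r).const_mul (-(μ * β))).congr_deriv (by simp))
    (fun r _ => by
      have e0 : HasDerivAt (fun x => exp (μ * β * x)) (exp (μ * β * r) * (μ * β * 1)) r :=
        ((hasDerivAt_id' r).const_mul (μ * β)).exp
      refine (e0.const_mul (σ / (μ * β))).congr_deriv ?_
      field_simp)
    (fun r hr => by
      have hc0 : 0 ≤ X r 2 := c_nonneg hX h0 hσ (hT.trans hr.1)
      have ha : X r 0 ^ 2 ≤ 1 := traj_sq_le_one hX h0 r 0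
      have hbr := hb r hr
      have h1 : σ * X r 0 ^ 2 + μ * X r 1 * X r 2 - -(μ * β) * X r 2 ≤ σ := by
        have : μ * X r 2 * (X r 1 + β) ≤ 0 :=
          mul_nonpos_of_nonneg_of_nonpos (mul_nonneg hμ.le hc0) (by linarith)
        nlinarith [mul_le_mul_of_nonneg_left ha hσ]
      show (σ * X r 0 ^ 2 + μ * X r 1 * X r 2 - -(μ * β) * X r 2) * exp (-(-(μ * β) * r))
          ≤ σ * exp (μ * β * r)
      rw [show -(-(μ * β) * r) = μ * β * r by ring]
      exact mul_le_mul_of_nonneg_right h1 (exp_pos _).le)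
  have h := hanti (left_mem_Icc.2 (ht.1.trans ht.2)) ht ht.1
  dsimp only at h
  rw [show -(-(μ * β) * t) = μ * β * t by ring, show -(-(μ * β) * T) = μ * β * T by ring] at h
  have hpos : 0 < exp (μ * β * t) := exp_pos _
  have hq0 : 0 ≤ σ / (μ * β) * exp (μ * β * T) := by positivity
  have hE : exp (-(μ * β * (t - T))) * exp (μ * β * t) = exp (μ * β * T) := by
    rw [← exp_add]; congr 1; ring
  have key : 0 ≤ (X T 2 * exp (-(μ * β * (t - T))) + σ / (μ * β) - X t 2) * exp (μ * β * t) := by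
    have : (X T 2 * exp (-(μ * β * (t - T))) + σ / (μ * β) - X t 2) * exp (μ * β * t)
        = X T 2 * exp (μ * β * T) + σ / (μ * β) * exp (μ * β * t) - X t 2 * exp (μ * β * t) := by
      rw [← hE]; ring
    rw [this]; linarith
  have := (mul_nonneg_iff_of_pos_right hpos).1 key
  linarith

/-! ## §12 The carrier freeze and the afterglow law -/

/-- Pointwise: with `|a|, |d| ≤ 1`, `c ≥ 0`, `b ≤ 0` and `ε, σ, R ≥ 0`,
`∂ₜ(a²) = -2Rcad - 2εa²b - 2σa²c ≥ -2(R+σ)c` — a reversed clock pumps INTO the carrier, and rotor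
and seed can take out at most `2(R+σ)c`. [cite: Tao2016AveragedNS, §5.5 (5.5), (est)] -/
theorem carrier_sq_deriv_ge {a b c d : ℝ} (ha : |a| ≤ 1) (hd : |d| ≤ 1) (hc : 0 ≤ c) (hb : b ≤ 0)
    (hε : 0 ≤ ε) (hσ : 0 ≤ σ) (hR : 0 ≤ R) :
    -(2 * (R + σ) * c) ≤ -(2 * R * c * a * d) - 2 * ε * a ^ 2 * b - 2 * σ * a ^ 2 * c := by
  have ha' := abs_le.1 ha
  have hd' := abs_le.1 hd
  have ha2 : a ^ 2 ≤ 1 := by nlinarith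
  have had : a * d ≤ 1 := by nlinarith [sq_nonneg (a - d)]
  have h1 : R * c * (a * d) ≤ R * c * 1 := mul_le_mul_of_nonneg_left had (mul_nonneg hR hc)
  have h2 : 0 ≤ ε * a ^ 2 * -b := mul_nonneg (mul_nonneg hε (sq_nonneg a)) (neg_nonneg.2 hb)
  have h3 : σ * c * a ^ 2 ≤ σ * c * 1 := mul_le_mul_of_nonneg_left ha2 (mul_nonneg hσ hc)
  linarith

/-- **CARRIER FREEZE.** If the clock is reversed, `b ≤ -β` on `[T, T']` (`β > 0`, `μ > 0`, `T ≥ 0`,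
`ε, σ, R ≥ 0`), then for `t ∈ [T, T']`:  `a(t)² ≥ a(T)² - 2(R+σ)(c(T) + σ(t-T))/(μβ)` — the carrier
can lose at most the rotor/seed AFTERGLOW `2(R+σ)·c(T)/(μβ)` (the action left in a trigger that
decays at rate `μβ`, `pulse_decay`) plus the seed leak; it is frozen once `R·c(T) ≪ μβ`.
[cite: Tao2016AveragedNS, §5.5 (5.5), (b-eq), (est)] -/
theorem carrier_freeze (hX : ∀ t, HasDerivAt X (fiveGateCircuit ε σ μ R K (X t)) t)
    (h0 : X 0 = delayInit) (hε : 0 ≤ ε) (hσ : 0 ≤ σ) (hμ : 0 < μ) (hR : 0 ≤ R) {T T' β : ℝ}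
    (hT : 0 ≤ T) (hβ : 0 < β) (hb : ∀ t ∈ Icc T T', X t 1 ≤ -β) {t : ℝ} (ht : t ∈ Icc T T') :
    X T 0 ^ 2 - 2 * (R + σ) * (X T 2 + σ * (t - T)) / (μ * β) ≤ X t 0 ^ 2 := by
  have hk : 0 < μ * β := mul_pos hμ hβ
  have hμ0 : μ ≠ 0 := hμ.ne'
  have hβ0 : β ≠ 0 := hβ.ne'
  have hcT : 0 ≤ X T 2 := c_nonneg hX h0 hσ hT
  -- the majorant of `c` from `pulse_decay` and its primitive
  have hmono := monotoneOn_sub_of_le_deriv (f := fun r => X r 0 ^ 2)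
    (f' := fun r => -(2 * R * X r 2 * X r 0 * X r 3) - 2 * ε * X r 0 ^ 2 * X r 1
      - 2 * σ * X r 0 ^ 2 * X r 2)
    (φ := fun r => -(2 * (R + σ) * (X T 2 * exp (-(μ * β * (r - T))) + σ / (μ * β))))
    (Φ := fun r => 2 * (R + σ) * (X T 2 / (μ * β) * exp (-(μ * β * (r - T))) - σ / (μ * β) * r))
    (convex_Icc T T') (fun r _ => hasDerivAt_a_sq hX r)
    (fun r _ => by
      have e1 : HasDerivAt (fun x => exp (-(μ * β * (x - T))))
          (exp (-(μ * β * (r - T))) * -(μ * β * 1)) r :=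
        (((hasDerivAt_id' r).sub_const T).const_mul (μ * β)).neg.exp
      refine (((e1.const_mul (X T 2 / (μ * β))).sub
        ((hasDerivAt_id' r).const_mul (σ / (μ * β)))).const_mul (2 * (R + σ))).congr_deriv ?_
      field_simp
      ring)
    (fun r hr => by
      have hcr : 0 ≤ X r 2 := c_nonneg hX h0 hσ (hT.trans hr.1)
      have hdec := pulse_decay hX h0 hσ hμ hT hβ hb hr
      have hpt := carrier_sq_deriv_ge (ε := ε) (σ := σ) (R := R) (traj_abs_le_one hX h0 r 0)
        (traj_abs_le_one hX h0 r 3) hcr ((hb r hr).trans (by linarith)) hε hσ hR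
      have hRσ : 0 ≤ 2 * (R + σ) := by positivity
      show -(2 * (R + σ) * (X T 2 * exp (-(μ * β * (r - T))) + σ / (μ * β)))
          ≤ -(2 * R * X r 2 * X r 0 * X r 3) - 2 * ε * X r 0 ^ 2 * X r 1 - 2 * σ * X r 0 ^ 2 * X r 2
      nlinarith [mul_le_mul_of_nonneg_left hdec hRσ])
  have h := hmono (left_mem_Icc.2 (ht.1.trans ht.2)) ht ht.1
  dsimp only at h
  simp only [sub_self, mul_zero, neg_zero, exp_zero, mul_one] at h
  -- h : a(T)² - Φ(T) ≤ a(t)² - Φ(t); now Φ(t) - Φ(T) ≥ -2(R+σ)(c(T) + σ(t-T))/(μβ)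
  have hexp : 0 ≤ exp (-(μ * β * (t - T))) := (exp_pos _).le
  have hRσ : 0 ≤ 2 * (R + σ) := by positivity
  have hq : 0 ≤ X T 2 / (μ * β) := div_nonneg hcT hk.le
  have h3 : 0 ≤ 2 * (R + σ) * (X T 2 / (μ * β) * exp (-(μ * β * (t - T)))) := by positivity
  have hsplit : 2 * (R + σ) * (X T 2 + σ * (t - T)) / (μ * β)
      = 2 * (R + σ) * (X T 2 / (μ * β)) + 2 * (R + σ) * (σ / (μ * β)) * (t - T) := by
    field_simp
  rw [hsplit]
  linarith [h, h3]

/-- **AFTERGLOW LAW (output ceiling after clock death).** If `b ≤ -β` on `[T, T']` (`β > 0`, `μ >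
0`, `T ≥ 0`, `ε, σ, R ≥ 0`; every `K`) then for `t ∈ [T, T']`:
`ã(t)² ≤ 1 - a(T)² + 2(R+σ)(c(T) + σ(t-T))/(μβ)` — by (energy-con) the gate can deliver at most the
energy already OUT of the carrier when the clock reversed, plus the afterglow. Complete transfer
(`ã → 1`) with a dead clock therefore needs `a(T)² ≲` afterglow: the carrier (nearly) EMPTY — or
in the right phase — when the rotor stops. [cite: Tao2016AveragedNS, §5.5 Theorem 5.3,
(energy-con)] -/
theorem afterglow_law (hX : ∀ t, HasDerivAt X (fiveGateCircuit ε σ μ R K (X t)) t)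
    (h0 : X 0 = delayInit) (hε : 0 ≤ ε) (hσ : 0 ≤ σ) (hμ : 0 < μ) (hR : 0 ≤ R) {T T' β : ℝ}
    (hT : 0 ≤ T) (hβ : 0 < β) (hb : ∀ t ∈ Icc T T', X t 1 ≤ -β) {t : ℝ} (ht : t ∈ Icc T T') :
    X t 4 ^ 2 ≤ 1 - X T 0 ^ 2 + 2 * (R + σ) * (X T 2 + σ * (t - T)) / (μ * β) := by
  have hfr := carrier_freeze hX h0 hε hσ hμ hR hT hβ hb ht
  have hen := energy_init hX h0 t
  simp only [energy, Fin.sum_univ_five] at hen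
  nlinarith [sq_nonneg (X t 1), sq_nonneg (X t 2), sq_nonneg (X t 3)]

/-- **SELF-TIMED AFTERGLOW LAW.** If at some time `T ≥ 0` the clock has been driven down to
`b(T) ≤ -β₀ < 0` (`ε, μ > 0`, `σ, R ≥ 0`), then on the recovery window `[T, T + β₀/(2ε)]`:
`ã(t)² ≤ 1 - a(T)² + 4(R+σ)(c(T) + σ(t-T))/(μβ₀)` (`clock_stays_reversed` + `afterglow_law` with
`β = β₀/2`). [cite: Tao2016AveragedNS, §5.5 Theorem 5.3, (b-eq), (energy-con)] -/
theorem afterglow_selftimed (hX : ∀ t, HasDerivAt X (fiveGateCircuit ε σ μ R K (X t)) t)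
    (h0 : X 0 = delayInit) (hε : 0 < ε) (hσ : 0 ≤ σ) (hμ : 0 < μ) (hR : 0 ≤ R) {T β₀ : ℝ}
    (hT : 0 ≤ T) (hβ₀ : 0 < β₀) (hbT : X T 1 ≤ -β₀) {t : ℝ} (ht : t ∈ Icc T (T + β₀ / (2 * ε))) :
    X t 4 ^ 2 ≤ 1 - X T 0 ^ 2 + 4 * (R + σ) * (X T 2 + σ * (t - T)) / (μ * β₀) := by
  have hwin : ∀ s ∈ Icc T (T + β₀ / (2 * ε)), X s 1 ≤ -(β₀ / 2) :=
    fun s hs => clock_stays_reversed hX h0 hε hμ.le hbT hs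
  have h := afterglow_law hX h0 hε.le hσ hμ hR hT (by positivity : 0 < β₀ / 2) hwin ht
  have heq : 2 * (R + σ) * (X T 2 + σ * (t - T)) / (μ * (β₀ / 2))
      = 4 * (R + σ) * (X T 2 + σ * (t - T)) / (μ * β₀) := by
    field_simp
    ring
  linarith [heq ▸ h]

/-! ## §13 Tao's family `σ = ε²e^{-M}`, `μ = ε⁻¹M`, `R = ε⁻²` -/

/-- **PULSE LIFETIME, Tao's family.** A trigger pulse `c ≥ γ̂ε` held on `[T, T+τ]` with
`2T + τ < M·γ̂²·τ` kills the clock: `b(T+τ) < 0` (`0 < ε ≤ 1`, `M ≥ 0`, `T, τ, γ̂ ≥ 0`). Since the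
amplifier preserves `b² + c² ≤ ((ε+σ)t)²`, the pulse height is `γ̂ ≈ t_c` (the clock level at
firing), so the clock dies `≈ 2T/(Mγ̂²)` after firing — long before a drain-limited douse of
duration `≳ log(1/δ)/(2K)` (part 4, `output_deficit_ge`) completes, unless `M ≲ K/log K`.
[cite: Tao2016AveragedNS, §5.5 (b-eq)] -/
theorem taoFamily_pulse_kills_clock {K M ε : ℝ} {X : ℝ → Fin 5 → ℝ}
    (hX : ∀ t, HasDerivAt X (delayCircuitWith K M ε (X t)) t) (h0 : X 0 = delayInit)
    (hε : 0 < ε) (hε1 : ε ≤ 1) (hM : 0 ≤ M) {T τ γ : ℝ} (hT : 0 ≤ T) (hτ : 0 ≤ τ) (hγ : 0 ≤ γ)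
    (hc : ∀ t ∈ Icc T (T + τ), γ * ε ≤ X t 2) (hlong : 2 * T + τ < M * γ ^ 2 * τ) :
    X (T + τ) 1 < 0 := by
  rw [delayCircuitWith_eq_fiveGate] at hX
  have hσ : 0 ≤ ε ^ 2 * exp (-M) := by positivity
  have hμ : 0 ≤ ε⁻¹ * M := by positivity
  refine pulse_kills_clock hX h0 hε.le hσ hμ hT hτ (by positivity : 0 ≤ γ * ε) hc ?_
  have hσε : ε ^ 2 * exp (-M) ≤ ε := by
    have h1 : exp (-M) ≤ 1 := exp_le_one_iff.2 (by linarith)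
    nlinarith [mul_le_mul (show ε ^ 2 ≤ ε by nlinarith) h1 (exp_pos _).le hε.le]
  have hkey : ε⁻¹ * M * (γ * ε) ^ 2 * τ = ε * (M * γ ^ 2 * τ) := by
    field_simp
  rw [hkey]
  have h2 : (ε ^ 2 * exp (-M)) * T ≤ ε * T := mul_le_mul_of_nonneg_right hσε hT
  nlinarith [mul_lt_mul_of_pos_left hlong hε]

/-- **AFTERGLOW LAW, Tao's family.** If `b ≤ -β` on `[T, T']` (`β > 0`, `T ≥ 0`, `0 < ε ≤ 1`, `M >
0`) then for `t ∈ [T, T']`:  `ã(t)² ≤ 1 - a(T)² + 4·(c(T) + ε²e^{-M}(t-T))/(ε·M·β)`. In units `c(T)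
= γ̂ε`, `β = β̂ε`: the afterglow is `4γ̂/(εMβ̂)` + seed leak — the carrier freezes once the trigger
has decayed to `γ̂ ≪ εMβ̂`, i.e. `log(1/(εM))` e-folds (time `≈ log(1/(εM))/(Mβ̂)`) after the clock
reversed. [cite: Tao2016AveragedNS, §5.5 Theorem 5.3, (energy-con)] -/
theorem taoFamily_afterglow {K M ε : ℝ} {X : ℝ → Fin 5 → ℝ}
    (hX : ∀ t, HasDerivAt X (delayCircuitWith K M ε (X t)) t) (h0 : X 0 = delayInit)
    (hε : 0 < ε) (hε1 : ε ≤ 1) (hM : 0 < M) {T T' β : ℝ} (hT : 0 ≤ T) (hβ : 0 < β)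
    (hb : ∀ t ∈ Icc T T', X t 1 ≤ -β) {t : ℝ} (ht : t ∈ Icc T T') :
    X t 4 ^ 2 ≤ 1 - X T 0 ^ 2 + 4 * (X T 2 + ε ^ 2 * exp (-M) * (t - T)) / (ε * M * β) := by
  rw [delayCircuitWith_eq_fiveGate] at hX
  have hσ : 0 ≤ ε ^ 2 * exp (-M) := by positivity
  have hμ : 0 < ε⁻¹ * M := by positivity
  have hR : 0 ≤ (ε ^ 2)⁻¹ := by positivity
  have h := afterglow_law hX h0 hε.le hσ hμ hR hT hβ hb ht
  have hcT : 0 ≤ X T 2 := c_nonneg hX h0 hσ hT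
  have hP : 0 ≤ X T 2 + ε ^ 2 * exp (-M) * (t - T) := by nlinarith [ht.1]
  -- `R + σ ≤ 2ε⁻²` and `μβ = Mβ/ε`
  have hRσ : (ε ^ 2)⁻¹ + ε ^ 2 * exp (-M) ≤ 2 * (ε ^ 2)⁻¹ := by
    have h1 : ε ^ 2 * exp (-M) ≤ 1 := by
      have : exp (-M) ≤ 1 := exp_le_one_iff.2 (by linarith)
      nlinarith [mul_le_mul (show ε ^ 2 ≤ 1 by nlinarith) this (exp_pos _).le zero_le_one]
    have h2 : (1 : ℝ) ≤ (ε ^ 2)⁻¹ := one_le_inv_iff₀.2 ⟨by positivity, by nlinarith⟩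
    linarith
  have hbound : 2 * ((ε ^ 2)⁻¹ + ε ^ 2 * exp (-M)) * (X T 2 + ε ^ 2 * exp (-M) * (t - T))
      / (ε⁻¹ * M * β) ≤ 4 * (X T 2 + ε ^ 2 * exp (-M) * (t - T)) / (ε * M * β) := by
    rw [div_le_div_iff₀ (by positivity) (by positivity)]
    have : 4 * (X T 2 + ε ^ 2 * exp (-M) * (t - T)) * (ε⁻¹ * M * β)
        = 2 * (2 * (ε ^ 2)⁻¹) * (X T 2 + ε ^ 2 * exp (-M) * (t - T)) * (ε * M * β) := by
      field_simp
      ring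
    rw [this]
    have hw : 0 ≤ (X T 2 + ε ^ 2 * exp (-M) * (t - T)) * (ε * M * β) := by positivity
    nlinarith [mul_le_mul_of_nonneg_right hRσ hw]
  linarith

end Summit.NavierStokesRegularity.FluidComputer.GateBudget
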